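import Literature.Topology.FourManifolds.HandleAttachingMapsInversion
import Literature.Topology.FourManifolds.PalaisBallComplement
import HarnessLib

/-!
# Locality of handle attachments: `M ∪ H^λ` only depends on `h̄` near the attaching sphere

Topic `Literature/Topology/FourManifolds`; third formal step (after
`HandleAttachingMapsTransport.lean` and `HandleAttachingMapsSymmetry.lean`) of the proof of the
isotopy invariance of handle attachment (Kosinski, *Differential Manifolds* (1993), VI §6
with VIII, proof of (1.2); the tree's named fact
`Literature.Geometry.Symplectic.HandleAttachingMap.isMultiAttachment_of_linkIsotopyInBoundary`).

In Kosinski's definition `M ∪ H^λ = (M ∖ h(S)) ∪ (Dᵐ ∖ S)`, `x ∈ T ∖ S ∼ h̄α(x)` (VI §6), the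
identification runs over the whole of `T ∖ S`, but the inversion `α` ((6.1)) exchanges the
vicinity of the belt disc `{x_λ = 0}` with the vicinity of the attaching sphere
`S = {|x_λ| = 1}`, and `Dᵐ ∖ S = (T ∖ S) ∪ {x_λ = 0}`; so the glued manifold is
`(M ∖ h(S)) ∪ {|x_λ|² < ε}` glued along `h̄α` on `{0 < |x_λ|² < ε}`, where `α` takes values in
`{|x_λ|² > 1 - ε}` — **the attachment only depends on the restriction of `h̄` to the
neighbourhood `{|x_λ|² > 1 - ε}` of `S` in `T`**.  This is the remark with which Kosinski
begins the uniqueness discussion of connected sums (VI §1, proof of (1.1): *"Notice now that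
`M` depends only on `h₂α_m h₁⁻¹` restricted to `h₁(ℝᵐ(t₀, t₁))`"*), transposed to handles.
Precisely (`HandleAttachingMap.IsMultiAttachment.of_eqOn_near_sphere`):

> if `gᵢ = h̄ᵢ` on `{y ∈ T : |y_λ|² > 1 - ε}` for some `ε > 0` and all `i`, and the `h̄ᵢ` have
> pairwise disjoint ranges, then every `P` which is `M` with handles attached along the `gᵢ`
> (`HandleAttachingMap.IsMultiAttachment g (𝓡∂ m) P`) is `M` with handles attached along the
> `h̄ᵢ`.

*Proof.* The cores agree, so the embedding `jA` of `M ∖ ⋃ gᵢ(S) = M ∖ ⋃ h̄ᵢ(S)` is kept.  The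
new `i`-th handle embedding `Dᵐ ∖ S → P` is `jBᵢ` on `{|x_λ|² < ε}` and `jA ∘ h̄ᵢ ∘ α` on
`{x_λ ≠ 0}` (`LocalityData.jB'`); the two agree on the overlap because there `α x` lies in
`{|y_λ|² > 1 - ε}` where `gᵢ = h̄ᵢ`, and `jA (gᵢ y) = jBᵢ (α y)` is the gluing relation of the
given attachment (`LocalityData.jB_eq_jA_attach`).  It is an immersion (locally one of two
immersions: `α : Dᵐ ∖ S ⇀ T` is a partial diffeomorphism, `HandleAttachingMapsInversion.lean`,
and immersions compose with partial diffeomorphisms, open embeddings and codomain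
restrictions), injective and open, hence a smooth embedding with open range; the covering,
gluing and disjointness clauses are bookkeeping with the involution `α`.

No correction of `jA` is needed here; by contrast, two attaching maps which merely agree on the
*sphere part* `T ∩ ∂Dᵐ` near `S` give attachments that are still diffeomorphic (Kosinski VI §5:
independence of the extension `h̄`, a form of the uniqueness of collars) but not by such a direct
re-presentation — that step is kept separate.  Everything here is proved; no named facts.

## References

* A. A. Kosinski, *Differential Manifolds*, Academic Press (1993), VI §1 (proof of (1.1)), VI §6,
  (6.1). [Kosinski1993]
-/

open scoped Manifold ContDiff Topology
open Set Function Metric Filter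

noncomputable section

namespace Literature.Topology.FourManifolds

universe u

/-- Local notation: `𝔼 n` is the model Euclidean space `EuclideanSpace ℝ (Fin n)`. -/
local notation "𝔼 " n:arg => EuclideanSpace ℝ (Fin n)

/-- Local notation: `𝔻 n` is the closed unit ball in `EuclideanSpace ℝ (Fin n)`. -/
local notation "𝔻 " n:arg => (Metric.closedBall (0 : EuclideanSpace ℝ (Fin n)) 1)

namespace HandleAttachingMap

variable {n k : ℕ} {M : Type u} [TopologicalSpace M] [T2Space M]
  [ChartedSpace (EuclideanHalfSpace (n + 1)) M]
  {ι : Type*} [Finite ι] {g h : ι → HandleAttachingMap n k M}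
  {P : Type*} [TopologicalSpace P] [ChartedSpace (EuclideanHalfSpace (n + 1)) P]

omit [T2Space M] in
/-- An attaching map is an open map (an embedding of full dimension with open range).
[folklore] -/
theorem isOpenMap_toFun (f : HandleAttachingMap n k M) : IsOpenMap f.toFun :=
  (Topology.IsOpenEmbedding.mk f.isSmoothEmbedding.isEmbedding f.isOpen_range).isOpenMap

/-- **Data of the locality argument**: an attachment of `P` along the family `g` (the fields
`jA`, `jB`, … are the clauses of `HandleAttachingMap.IsMultiAttachment g (𝓡∂ m) P`), a
family `h` agreeing with `g` on the neighbourhood `{|y_λ|² > 1 - ε}` of the attaching sphere in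
`T`, with pairwise disjoint ranges.  (Proof-internal packaging; the statement proved from it
is `HandleAttachingMap.IsMultiAttachment.of_eqOn_near_sphere`.) [folklore] -/
structure LocalityData (g h : ι → HandleAttachingMap n k M) (P : Type*) [TopologicalSpace P]
    [ChartedSpace (EuclideanHalfSpace (n + 1)) P] where
  /-- the width of the neighbourhood of `S` on which `g = h` -/
  ε : ℝ
  /-- … is positive -/
  ε_pos : 0 < ε
  /-- `gᵢ = h̄ᵢ` on `{|y_λ|² > 1 - ε}` -/
  eqOn : ∀ i (y : ↥(handleTube n k)), 1 - ε < lamSq k (((y : 𝔻 (n + 1)) : 𝔼 (n + 1))) →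
    (g i).toFun y = (h i).toFun y
  /-- the `h̄ᵢ` have pairwise disjoint ranges -/
  disjoint : Pairwise fun i j => Disjoint (range (h i).toFun) (range (h j).toFun)
  /-- the `gᵢ` have pairwise disjoint ranges -/
  disjointG : Pairwise fun i j => Disjoint (range (g i).toFun) (range (g j).toFun)
  /-- the embedding of `M ∖ ⋃ gᵢ(S)` -/
  jA : ↥(coresComplement g) → P
  /-- the handle embeddings -/
  jB : ι → ↥(beltPiece n k) → P
  /-- `jA` is a smooth embedding … -/
  hjA : Manifold.IsSmoothEmbedding (𝓡∂ (n + 1)) (𝓡∂ (n + 1)) ∞ jA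
  /-- … with open range -/
  hjAo : IsOpen (range jA)
  /-- the `jBᵢ` are smooth embeddings with open ranges -/
  hjB : ∀ i, Manifold.IsSmoothEmbedding (𝓡∂ (n + 1)) (𝓡∂ (n + 1)) ∞ (jB i) ∧ IsOpen (range (jB i))
  /-- the pieces cover `P` -/
  cover : range jA ∪ (⋃ i, range (jB i)) = univ
  /-- the pieces meet along Kosinski's gluing relation -/
  glue : ∀ i a b, jA a = jB i b ↔ (g i).glueRel (a : M) (b : 𝔻 (n + 1))
  /-- the handles are pairwise disjoint -/
  disjointB : Pairwise fun i j => Disjoint (range (jB i)) (range (jB j))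

namespace LocalityData

/-! #### The cores agree -/

/-- `gᵢ = h̄ᵢ` on the attaching sphere. [folklore] -/
theorem apply_eq_of_lamSq_eq_one (D : LocalityData g h P) (i : ι) (y : ↥(handleTube n k))
    (hy : lamSq k (((y : 𝔻 (n + 1)) : 𝔼 (n + 1))) = 1) : (g i).toFun y = (h i).toFun y :=
  D.eqOn i y (by rw [hy]; linarith [D.ε_pos])

/-- The cores of `gᵢ` and `h̄ᵢ` agree. [folklore] -/
theorem core_eq (D : LocalityData g h P) (i : ι) : (g i).core = (h i).core := by
  ext a
  simp only [mem_core_iff]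
  constructor
  · rintro ⟨y, hy, rfl⟩; exact ⟨y, hy, (D.apply_eq_of_lamSq_eq_one i y hy).symm⟩
  · rintro ⟨y, hy, rfl⟩; exact ⟨y, hy, D.apply_eq_of_lamSq_eq_one i y hy⟩

/-- Hence the complements of the cores agree. [folklore] -/
theorem mem_coresComplement_iff (D : LocalityData g h P) {a : M} : a ∈ coresComplement h ↔ a ∈ coresComplement g := by
  simp only [mem_coresComplement, D.core_eq]

/-- The identification `M ∖ ⋃ h̄ᵢ(S) ≅ M ∖ ⋃ gᵢ(S)` (restricted identity). [folklore] -/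
def ccCongr (D : LocalityData g h P) : ↥(coresComplement h) ≃ₘ⟮𝓡∂ (n + 1), 𝓡∂ (n + 1)⟯ ↥(coresComplement g) :=
  opensCongr (Diffeomorph.refl (𝓡∂ (n + 1)) M ∞) _ _ fun _ => D.mem_coresComplement_iff

/-- `ccCongr` is the identity on points. [folklore] -/
@[simp] theorem coe_ccCongr (D : LocalityData g h P) (a : ↥(coresComplement h)) : ((D.ccCongr a : ↥(coresComplement g)) : M) = a :=
  rfl

/-- Points `h̄ᵢ(y)`, `y ∈ T ∖ S`, lie off all the cores. [folklore] -/
theorem apply_mem_coresComplement (D : LocalityData g h P) (i : ι) (y : ↥(handleTube n k))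
    (hy : lamSq k (((y : 𝔻 (n + 1)) : 𝔼 (n + 1))) ≠ 1) : (h i).toFun y ∈ coresComplement g := by
  rw [← D.mem_coresComplement_iff, mem_coresComplement]
  intro j
  by_cases hij : j = i
  · subst hij
    rintro ⟨y', hy', he⟩
    have := (h j).injective he
    subst this
    exact hy hy'
  · rintro ⟨y', -, he⟩
    exact Set.disjoint_left.1 (D.disjoint hij) (mem_range_self y') (by rw [he]; exact mem_range_self y)

/-- Points `gᵢ(y)`, `y ∈ T ∖ S`, lie off all the cores. [folklore] -/
theorem apply_mem_coresComplement_g (D : LocalityData g h P) (i : ι) (y : ↥(handleTube n k))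
    (hy : lamSq k (((y : 𝔻 (n + 1)) : 𝔼 (n + 1))) ≠ 1) : (g i).toFun y ∈ coresComplement g := by
  rw [mem_coresComplement]
  intro j
  by_cases hij : j = i
  · subst hij
    rintro ⟨y', hy', he⟩
    have := (g j).injective he
    subst this
    exact hy hy'
  · rintro ⟨y', -, he⟩
    exact Set.disjoint_left.1 (D.disjointG hij) (mem_range_self y') (by rw [he]; exact mem_range_self y)

/-! #### The new handle embeddings -/

/-- The point of `M ∖ ⋃ gᵢ(S)` attached to `b ∈ T ∖ S ⊆ Dᵐ ∖ S` by the `i`-th handle: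
`h̄ᵢ(α b)`. [folklore] -/
def attach (D : LocalityData g h P) (i : ι) (b : ↥(beltPiece n k)) (hb : lamSq k (((b : 𝔻 (n + 1)) : 𝔼 (n + 1))) ≠ 0) :
    ↥(coresComplement g) :=
  ⟨(h i).toFun (handleInversionPt (b : 𝔻 (n + 1)) hb b.2),
    D.apply_mem_coresComplement i _ (handleInversion_mem hb b.2).2.2⟩

/-- The underlying point of `attach`. [folklore] -/
@[simp] theorem coe_attach (D : LocalityData g h P) (i : ι) (b : ↥(beltPiece n k))
    (hb : lamSq k (((b : 𝔻 (n + 1)) : 𝔼 (n + 1))) ≠ 0) :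
    (D.attach i b hb : M) = (h i).toFun (handleInversionPt (b : 𝔻 (n + 1)) hb b.2) := rfl

/-- **Consistency on the overlap `{0 < |x_λ|² < ε}`**: there the given handle embedding already
is `jA ∘ h̄ᵢ ∘ α` — by the gluing relation `jA (gᵢ y) = jBᵢ (α y)` with `y = α b`, which lies
in `{|y_λ|² > 1 - ε}` where `gᵢ = h̄ᵢ`. [cite: Kosinski1993, VI §6] -/
theorem jB_eq_jA_attach (D : LocalityData g h P) (i : ι) (b : ↥(beltPiece n k))
    (hb0 : lamSq k (((b : 𝔻 (n + 1)) : 𝔼 (n + 1))) ≠ 0)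
    (hbε : lamSq k (((b : 𝔻 (n + 1)) : 𝔼 (n + 1))) < D.ε) : D.jB i b = D.jA (D.attach i b hb0) := by
  set y : ↥(handleTube n k) := handleInversionPt (b : 𝔻 (n + 1)) hb0 b.2 with hy_def
  have hb0' : 0 < lamSq k (((b : 𝔻 (n + 1)) : 𝔼 (n + 1))) :=
    lt_of_le_of_ne (lamSq_nonneg k _) (Ne.symm hb0)
  have hb1' : lamSq k (((b : 𝔻 (n + 1)) : 𝔼 (n + 1))) < 1 :=
    lt_of_le_of_ne (lamSq_le_one (mem_closedBall_zero_iff.1 (b : 𝔻 (n + 1)).2)) b.2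
  have hly : lamSq k (((y : 𝔻 (n + 1)) : 𝔼 (n + 1))) = 1 - lamSq k (((b : 𝔻 (n + 1)) : 𝔼 (n + 1))) := by
    rw [hy_def, coe_coe_handleInversionPt, lamSq_handleInversion hb0' hb1'.le]
  have hy1 : lamSq k (((y : 𝔻 (n + 1)) : 𝔼 (n + 1))) ≠ 1 := by rw [hly]; linarith
  have hgy : (g i).toFun y = (h i).toFun y := D.eqOn i y (by rw [hly]; linarith)
  -- the gluing relation of the given attachment at `(gᵢ y, α y)`
  have hrel := (g i).glueRel_apply y hy1
  have hmem : (g i).toFun y ∈ coresComplement g := by rw [hgy]; exact D.apply_mem_coresComplement i y hy1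
  have hαy : ((handleInversionPt (y : 𝔻 (n + 1)) y.2 hy1 : ↥(handleTube n k)) : 𝔻 (n + 1)) = b := by
    apply Subtype.ext
    rw [coe_coe_handleInversionPt, hy_def, coe_coe_handleInversionPt,
      handleInversion_handleInversion hb0' hb1']
  have h1 : D.jA ⟨(g i).toFun y, hmem⟩ = D.jB i b := by
    rw [D.glue i]
    show (g i).glueRel ((g i).toFun y) ((b : 𝔻 (n + 1)))
    rw [← hαy]; exact hrel
  rw [← h1]
  congr 1
  exact Subtype.ext hgy

/-- Off `{|x_λ|² < ε}` one has `x_λ ≠ 0`. [folklore] -/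
theorem lamSq_ne_zero_of_not_lt (D : LocalityData g h P) {b : ↥(beltPiece n k)}
    (hb : ¬ lamSq k (((b : 𝔻 (n + 1)) : 𝔼 (n + 1))) < D.ε) :
    lamSq k (((b : 𝔻 (n + 1)) : 𝔼 (n + 1))) ≠ 0 := fun h0 =>
  hb (by rw [h0]; exact D.ε_pos)

/-- **The new `i`-th handle embedding `Dᵐ ∖ S → P`**: `jBᵢ` on `{|x_λ|² < ε}`, and
`jA ∘ h̄ᵢ ∘ α` elsewhere (hence, by `jB_eq_jA_attach`, on all of `{x_λ ≠ 0}`).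
[cite: Kosinski1993, VI §6] -/
def jB' (D : LocalityData g h P) (i : ι) (b : ↥(beltPiece n k)) : P :=
  if hb : lamSq k (((b : 𝔻 (n + 1)) : 𝔼 (n + 1))) < D.ε then D.jB i b
  else D.jA (D.attach i b (D.lamSq_ne_zero_of_not_lt hb))

/-- `jB'ᵢ = jBᵢ` on `{|x_λ|² < ε}`. [folklore] -/
theorem jB'_of_lt (D : LocalityData g h P) (i : ι) {b : ↥(beltPiece n k)}
    (hb : lamSq k (((b : 𝔻 (n + 1)) : 𝔼 (n + 1))) < D.ε) : D.jB' i b = D.jB i b := by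
  rw [jB', dif_pos hb]

/-- `jB'ᵢ = jA ∘ h̄ᵢ ∘ α` on `{x_λ ≠ 0}`. [folklore] -/
theorem jB'_of_ne_zero (D : LocalityData g h P) (i : ι) {b : ↥(beltPiece n k)}
    (hb : lamSq k (((b : 𝔻 (n + 1)) : 𝔼 (n + 1))) ≠ 0) : D.jB' i b = D.jA (D.attach i b hb) := by
  by_cases hlt : lamSq k (((b : 𝔻 (n + 1)) : 𝔼 (n + 1))) < D.ε
  · rw [D.jB'_of_lt i hlt, D.jB_eq_jA_attach i b hb hlt]
  · rw [jB', dif_neg hlt]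

/-! #### Gluing relation, covering, disjointness, injectivity -/

omit [T2Space M] in
/-- If `b = α y` then `|y_λ|² = 1 - |b_λ|²`, so `y` is close to `S` when `b` is close to the
belt disc. [folklore] -/
theorem lamSq_eq_of_glueRel {b : 𝔻 (n + 1)} {y : ↥(handleTube n k)}
    (hb : (b : 𝔼 (n + 1)) = handleInversion k (((y : 𝔻 (n + 1)) : 𝔼 (n + 1)))) :
    lamSq k (((y : 𝔻 (n + 1)) : 𝔼 (n + 1))) = 1 - lamSq k (b : 𝔼 (n + 1)) := by
  have h0 : 0 < lamSq k (((y : 𝔻 (n + 1)) : 𝔼 (n + 1))) :=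
    lt_of_le_of_ne (lamSq_nonneg k _) (Ne.symm y.2)
  have h1 : lamSq k (((y : 𝔻 (n + 1)) : 𝔼 (n + 1))) ≤ 1 :=
    lamSq_le_one (mem_closedBall_zero_iff.1 (y : 𝔻 (n + 1)).2)
  rw [hb, lamSq_handleInversion h0 h1]; ring

/-- On `{|x_λ|² < ε}` the gluing relations of `gᵢ` and `h̄ᵢ` agree (the witness `y = α b` lies
where `gᵢ = h̄ᵢ`). [folklore] -/
theorem glueRel_iff_of_lt (D : LocalityData g h P) (i : ι) {a : M} {b : 𝔻 (n + 1)}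
    (hb : lamSq k (b : 𝔼 (n + 1)) < D.ε) : (g i).glueRel a b ↔ (h i).glueRel a b := by
  constructor
  · rintro ⟨y, hy1, hb', rfl⟩
    refine ⟨y, hy1, hb', D.eqOn i y ?_⟩
    rw [lamSq_eq_of_glueRel hb']; linarith
  · rintro ⟨y, hy1, hb', rfl⟩
    refine ⟨y, hy1, hb', (D.eqOn i y ?_).symm⟩
    rw [lamSq_eq_of_glueRel hb']; linarith

/-- **The gluing relation of the new presentation**: `jA a = jB'ᵢ b ↔ h̄ᵢ.glueRel a b`.
[cite: Kosinski1993, VI §6] -/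
theorem jA_eq_jB'_iff (D : LocalityData g h P) (i : ι) (a : ↥(coresComplement h)) (b : ↥(beltPiece n k)) :
    D.jA (D.ccCongr a) = D.jB' i b ↔ (h i).glueRel (a : M) (b : 𝔻 (n + 1)) := by
  by_cases hb : lamSq k (((b : 𝔻 (n + 1)) : 𝔼 (n + 1))) < D.ε
  · rw [D.jB'_of_lt i hb, D.glue i, coe_ccCongr]
    exact D.glueRel_iff_of_lt i hb
  · have hb0 := D.lamSq_ne_zero_of_not_lt hb
    rw [D.jB'_of_ne_zero i hb0, D.hjA.isEmbedding.injective.eq_iff]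
    have hb0' : 0 < lamSq k (((b : 𝔻 (n + 1)) : 𝔼 (n + 1))) :=
      lt_of_le_of_ne (lamSq_nonneg k _) (Ne.symm hb0)
    have hb1' : lamSq k (((b : 𝔻 (n + 1)) : 𝔼 (n + 1))) < 1 :=
      lt_of_le_of_ne (lamSq_le_one (mem_closedBall_zero_iff.1 (b : 𝔻 (n + 1)).2)) b.2
    constructor
    · intro he
      have he' : (a : M) = (h i).toFun (handleInversionPt (b : 𝔻 (n + 1)) hb0 b.2) := by
        rw [← coe_attach D i b hb0, ← he]; rfl
      refine ⟨handleInversionPt (b : 𝔻 (n + 1)) hb0 b.2, (handleInversion_mem hb0 b.2).2.2, ?_, he'⟩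
      rw [coe_coe_handleInversionPt, handleInversion_handleInversion hb0' hb1']
    · rintro ⟨y, hy1, hb', ha⟩
      apply Subtype.ext
      rw [coe_ccCongr, coe_attach, ha]
      congr 1
      apply Subtype.ext; apply Subtype.ext
      have h0 : 0 < lamSq k (((y : 𝔻 (n + 1)) : 𝔼 (n + 1))) :=
        lt_of_le_of_ne (lamSq_nonneg k _) (Ne.symm y.2)
      have h1 : lamSq k (((y : 𝔻 (n + 1)) : 𝔼 (n + 1))) < 1 :=
        lt_of_le_of_ne (lamSq_le_one (mem_closedBall_zero_iff.1 (y : 𝔻 (n + 1)).2)) hy1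
      rw [coe_coe_handleInversionPt, hb', handleInversion_handleInversion h0 h1]

/-- Points of the old handles off `{|x_λ|² < ε}` already lie in the image of `jA`. [folklore] -/
theorem jB_mem_range_jA (D : LocalityData g h P) (i : ι) {b : ↥(beltPiece n k)}
    (hb0 : lamSq k (((b : 𝔻 (n + 1)) : 𝔼 (n + 1))) ≠ 0) : D.jB i b ∈ range D.jA := by
  set y : ↥(handleTube n k) := handleInversionPt (b : 𝔻 (n + 1)) hb0 b.2 with hy_def
  have hb0' : 0 < lamSq k (((b : 𝔻 (n + 1)) : 𝔼 (n + 1))) :=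
    lt_of_le_of_ne (lamSq_nonneg k _) (Ne.symm hb0)
  have hb1' : lamSq k (((b : 𝔻 (n + 1)) : 𝔼 (n + 1))) < 1 :=
    lt_of_le_of_ne (lamSq_le_one (mem_closedBall_zero_iff.1 (b : 𝔻 (n + 1)).2)) b.2
  have hy1 : lamSq k (((y : 𝔻 (n + 1)) : 𝔼 (n + 1))) ≠ 1 := (handleInversion_mem hb0 b.2).2.2
  have hrel := (g i).glueRel_apply y hy1
  have hαy : ((handleInversionPt (y : 𝔻 (n + 1)) y.2 hy1 : ↥(handleTube n k)) : 𝔻 (n + 1)) = b := by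
    apply Subtype.ext
    rw [coe_coe_handleInversionPt, hy_def, coe_coe_handleInversionPt,
      handleInversion_handleInversion hb0' hb1']
  have hmem : (g i).toFun y ∈ coresComplement g := D.apply_mem_coresComplement_g i y hy1
  refine ⟨⟨(g i).toFun y, hmem⟩, ?_⟩
  rw [D.glue i]
  show (g i).glueRel ((g i).toFun y) (b : 𝔻 (n + 1))
  rw [← hαy]; exact hrel

/-- **The pieces still cover `P`.** [folklore] -/
theorem cover' (D : LocalityData g h P) :
    range (D.jA ∘ D.ccCongr) ∪ (⋃ i, range (D.jB' i)) = univ := by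
  have hr : range (D.jA ∘ D.ccCongr) = range D.jA := D.ccCongr.surjective.range_comp _
  rw [hr, eq_univ_iff_forall]
  intro p
  have hp : p ∈ range D.jA ∪ ⋃ i, range (D.jB i) := by rw [D.cover]; exact mem_univ p
  rcases hp with hp | hp
  · exact Or.inl hp
  · obtain ⟨i, b, rfl⟩ : ∃ i b, D.jB i b = p := by simpa only [mem_iUnion, mem_range] using hp
    by_cases hb : lamSq k (((b : 𝔻 (n + 1)) : 𝔼 (n + 1))) < D.ε
    · exact Or.inr (mem_iUnion.2 ⟨i, b, D.jB'_of_lt i hb⟩)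
    · exact Or.inl (D.jB_mem_range_jA i (D.lamSq_ne_zero_of_not_lt hb))

/-- A coincidence `jBᵢ b = jA (h̄ⱼ (α b'))` with `|b_λ|² < ε` forces `i = j` and `b = b'`.
[folklore] -/
theorem eq_of_jB_eq_jA_attach (D : LocalityData g h P) {i j : ι} {b b' : ↥(beltPiece n k)}
    (hb : lamSq k (((b : 𝔻 (n + 1)) : 𝔼 (n + 1))) < D.ε)
    (hb' : lamSq k (((b' : 𝔻 (n + 1)) : 𝔼 (n + 1))) ≠ 0)
    (he : D.jB i b = D.jA (D.attach j b' hb')) : i = j ∧ b = b' := by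
  have hrel : (g i).glueRel (D.attach j b' hb' : M) (b : 𝔻 (n + 1)) := (D.glue i _ _).1 he.symm
  obtain ⟨y, hy1, hby, hay⟩ := hrel
  have hgy : (g i).toFun y = (h i).toFun y := D.eqOn i y (by rw [lamSq_eq_of_glueRel hby]; linarith)
  rw [coe_attach, hgy] at hay
  -- `h̄ⱼ (α b') = h̄ᵢ y`: the ranges of distinct `h̄`'s are disjoint, so `i = j`
  have hij : i = j := by
    by_contra hij
    exact Set.disjoint_left.1 (D.disjoint hij) (mem_range_self y) (by rw [← hay]; exact mem_range_self _)
  subst hij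
  refine ⟨rfl, ?_⟩
  have hyy : handleInversionPt (b' : 𝔻 (n + 1)) hb' b'.2 = y := (h i).injective hay
  have hb0' : 0 < lamSq k (((b' : 𝔻 (n + 1)) : 𝔼 (n + 1))) :=
    lt_of_le_of_ne (lamSq_nonneg k _) (Ne.symm hb')
  have hb1' : lamSq k (((b' : 𝔻 (n + 1)) : 𝔼 (n + 1))) < 1 :=
    lt_of_le_of_ne (lamSq_le_one (mem_closedBall_zero_iff.1 (b' : 𝔻 (n + 1)).2)) b'.2
  apply Subtype.ext; apply Subtype.ext
  rw [hby, ← hyy, coe_coe_handleInversionPt, handleInversion_handleInversion hb0' hb1']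

/-- **The new handles are pairwise disjoint.** [folklore] -/
theorem disjointB' (D : LocalityData g h P) :
    Pairwise fun i j => Disjoint (range (D.jB' i)) (range (D.jB' j)) := by
  intro i j hij
  refine Set.disjoint_left.2 ?_
  rintro _ ⟨b, rfl⟩ ⟨b', he⟩
  by_cases hb : lamSq k (((b : 𝔻 (n + 1)) : 𝔼 (n + 1))) < D.ε <;>
    by_cases hb' : lamSq k (((b' : 𝔻 (n + 1)) : 𝔼 (n + 1))) < D.ε
  · rw [D.jB'_of_lt i hb, D.jB'_of_lt j hb'] at he
    exact Set.disjoint_left.1 (D.disjointB hij) (mem_range_self b) (by rw [← he]; exact mem_range_self b')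
  · rw [D.jB'_of_lt i hb, D.jB'_of_ne_zero j (D.lamSq_ne_zero_of_not_lt hb')] at he
    exact hij (D.eq_of_jB_eq_jA_attach hb _ he.symm).1
  · rw [D.jB'_of_ne_zero i (D.lamSq_ne_zero_of_not_lt hb), D.jB'_of_lt j hb'] at he
    exact hij (D.eq_of_jB_eq_jA_attach hb' _ he).1.symm
  · rw [D.jB'_of_ne_zero i (D.lamSq_ne_zero_of_not_lt hb),
      D.jB'_of_ne_zero j (D.lamSq_ne_zero_of_not_lt hb')] at he
    have he' := congrArg (fun a : ↥(coresComplement g) => (a : M)) (D.hjA.isEmbedding.injective he)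
    simp only [coe_attach] at he'
    have hmem : (h i).toFun (handleInversionPt (b : 𝔻 (n + 1)) (D.lamSq_ne_zero_of_not_lt hb) b.2) ∈
        range (h j).toFun := ⟨_, he'⟩
    exact Set.disjoint_left.1 (D.disjoint hij) (mem_range_self _) hmem

/-- **The new handle embeddings are injective.** [folklore] -/
theorem injective_jB' (D : LocalityData g h P) (i : ι) : Injective (D.jB' i) := by
  intro b b' he
  by_cases hb : lamSq k (((b : 𝔻 (n + 1)) : 𝔼 (n + 1))) < D.ε <;>
    by_cases hb' : lamSq k (((b' : 𝔻 (n + 1)) : 𝔼 (n + 1))) < D.ε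
  · rw [D.jB'_of_lt i hb, D.jB'_of_lt i hb'] at he
    exact (D.hjB i).1.isEmbedding.injective he
  · rw [D.jB'_of_lt i hb, D.jB'_of_ne_zero i (D.lamSq_ne_zero_of_not_lt hb')] at he
    exact (D.eq_of_jB_eq_jA_attach hb _ he).2
  · rw [D.jB'_of_ne_zero i (D.lamSq_ne_zero_of_not_lt hb), D.jB'_of_lt i hb'] at he
    exact (D.eq_of_jB_eq_jA_attach hb' _ he.symm).2.symm
  · have hb0 := D.lamSq_ne_zero_of_not_lt hb
    have hb0'' := D.lamSq_ne_zero_of_not_lt hb'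
    rw [D.jB'_of_ne_zero i hb0, D.jB'_of_ne_zero i hb0''] at he
    have he' := congrArg (fun a : ↥(coresComplement g) => (a : M)) (D.hjA.isEmbedding.injective he)
    simp only [coe_attach] at he'
    have hyy := (h i).injective he'
    have h0 : 0 < lamSq k (((b : 𝔻 (n + 1)) : 𝔼 (n + 1))) := lt_of_le_of_ne (lamSq_nonneg k _) (Ne.symm hb0)
    have h1 : lamSq k (((b : 𝔻 (n + 1)) : 𝔼 (n + 1))) < 1 :=
      lt_of_le_of_ne (lamSq_le_one (mem_closedBall_zero_iff.1 (b : 𝔻 (n + 1)).2)) b.2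
    have h0' : 0 < lamSq k (((b' : 𝔻 (n + 1)) : 𝔼 (n + 1))) := lt_of_le_of_ne (lamSq_nonneg k _) (Ne.symm hb0'')
    have h1' : lamSq k (((b' : 𝔻 (n + 1)) : 𝔼 (n + 1))) < 1 :=
      lt_of_le_of_ne (lamSq_le_one (mem_closedBall_zero_iff.1 (b' : 𝔻 (n + 1)).2)) b'.2
    have hv := congrArg (fun y : ↥(handleTube n k) => ((y : 𝔻 (n + 1)) : 𝔼 (n + 1))) hyy
    simp only [coe_coe_handleInversionPt] at hv
    apply Subtype.ext; apply Subtype.ext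
    rw [← handleInversion_handleInversion h0 h1, hv, handleInversion_handleInversion h0' h1']

/-! #### The new handle embeddings are open immersions -/

section Smooth

variable [IsManifold (𝓡∂ (n + 1)) ∞ M] [IsManifold (𝓡∂ (n + 1)) ∞ P]

omit [IsManifold (𝓡∂ (n + 1)) ∞ M] [IsManifold (𝓡∂ (n + 1)) ∞ P] in
/-- `jB'ᵢ` agrees with `jBᵢ` near every point of `{|x_λ|² < ε}`. [folklore] -/
theorem jB'_eventuallyEq_of_lt (D : LocalityData g h P) (i : ι) {b₀ : ↥(beltPiece n k)}
    (hb₀ : lamSq k (((b₀ : 𝔻 (n + 1)) : 𝔼 (n + 1))) < D.ε) : D.jB' i =ᶠ[𝓝 b₀] D.jB i := by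
  filter_upwards [(isOpen_lt (continuous_lamSq_beltPiece n k) continuous_const).mem_nhds hb₀]
    with b hb
  exact D.jB'_of_lt i hb

omit [IsManifold (𝓡∂ (n + 1)) ∞ M] [IsManifold (𝓡∂ (n + 1)) ∞ P] in
/-- **`jB'ᵢ` is an immersion at the points of `{|x_λ|² < ε}`.** [folklore] -/
theorem isImmersionAt_jB'_of_lt (D : LocalityData g h P) (i : ι) {b₀ : ↥(beltPiece n k)}
    (hb₀ : lamSq k (((b₀ : 𝔻 (n + 1)) : 𝔼 (n + 1))) < D.ε) :
    Manifold.IsImmersionAt (𝓡∂ (n + 1)) (𝓡∂ (n + 1)) ∞ (D.jB' i) b₀ :=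
  ((D.hjB i).1.isImmersion.isImmersionAt b₀).congr_of_eventuallyEq (D.jB'_eventuallyEq_of_lt i hb₀).symm

/-- The auxiliary total map `b ↦ h̄ᵢ (α b)` near a point `b₀ ∈ {x_λ ≠ 0}` (junk value
`h̄ᵢ (α b₀)` on the belt disc), with values in `M ∖ ⋃ gᵢ(S)`. [folklore] -/
def attachAux (D : LocalityData g h P) (i : ι) (b₀ : ↥(beltPiece n k))
    (hb₀ : lamSq k (((b₀ : 𝔻 (n + 1)) : 𝔼 (n + 1))) ≠ 0) (b : ↥(beltPiece n k)) :
    ↥(coresComplement g) :=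
  if hb : lamSq k (((b : 𝔻 (n + 1)) : 𝔼 (n + 1))) ≠ 0 then D.attach i b hb else D.attach i b₀ hb₀

omit [IsManifold (𝓡∂ (n + 1)) ∞ M] [IsManifold (𝓡∂ (n + 1)) ∞ P] in
/-- On `{x_λ ≠ 0}`, `attachAux` is `attach`. [folklore] -/
theorem attachAux_of_ne (D : LocalityData g h P) (i : ι) {b₀ : ↥(beltPiece n k)}
    (hb₀ : lamSq k (((b₀ : 𝔻 (n + 1)) : 𝔼 (n + 1))) ≠ 0) {b : ↥(beltPiece n k)}
    (hb : lamSq k (((b : 𝔻 (n + 1)) : 𝔼 (n + 1))) ≠ 0) : D.attachAux i b₀ hb₀ b = D.attach i b hb := by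
  rw [attachAux, dif_pos hb]

/-- **`jB'ᵢ` is an immersion at the points of `{x_λ ≠ 0}`**: there it is `jA ∘ h̄ᵢ ∘ α`, and
`α : Dᵐ ∖ S ⇀ T` is a partial diffeomorphism (`handleInversionPH`), `h̄ᵢ` an immersion, the
codomain restriction to the open `M ∖ ⋃ gᵢ(S)` and the open embedding `jA` preserve immersions.
[folklore] -/
theorem isImmersionAt_jB'_of_ne (D : LocalityData g h P) (i : ι) {b₀ : ↥(beltPiece n k)}
    (hb₀ : lamSq k (((b₀ : 𝔻 (n + 1)) : 𝔼 (n + 1))) ≠ 0) :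
    Manifold.IsImmersionAt (𝓡∂ (n + 1)) (𝓡∂ (n + 1)) ∞ (D.jB' i) b₀ := by
  haveI : Nonempty ↥(handleTube n k) := ⟨handleInversionPt (b₀ : 𝔻 (n + 1)) hb₀ b₀.2⟩
  obtain ⟨F, _, _, hF⟩ := (h i).isSmoothEmbedding.isImmersion
  -- `h̄ᵢ ∘ α` is an immersion at `b₀`
  have h1 : Manifold.IsImmersionAtOfComplement F (𝓡∂ (n + 1)) (𝓡∂ (n + 1)) ∞
      ((h i).toFun ∘ handleInversionPH n k) b₀ :=
    (hF (handleInversionPH n k b₀)).comp_openPartialHomeomorph (handleInversionPH n k)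
      (contMDiffOn_handleInversionPH n k) (contMDiffOn_handleInversionPH_symm n k) hb₀
  -- the auxiliary total map agrees with it near `b₀`
  have hopen : IsOpen {b : ↥(beltPiece n k) | lamSq k (((b : 𝔻 (n + 1)) : 𝔼 (n + 1))) ≠ 0} :=
    isOpen_ne.preimage (continuous_lamSq_beltPiece n k)
  have h2 : Manifold.IsImmersionAtOfComplement F (𝓡∂ (n + 1)) (𝓡∂ (n + 1)) ∞
      (fun b => (D.attachAux i b₀ hb₀ b : M)) b₀ := by
    refine h1.congr_of_eventuallyEq ?_
    filter_upwards [hopen.mem_nhds hb₀] with b hb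
    rw [D.attachAux_of_ne i hb₀ hb, coe_attach, comp_apply, handleInversionPH_apply n k hb]
  -- restrict the codomain to `M ∖ ⋃ gᵢ(S)` and compose with `jA`
  have h3 : Manifold.IsImmersionAtOfComplement F (𝓡∂ (n + 1)) (𝓡∂ (n + 1)) ∞
      (D.attachAux i b₀ hb₀) b₀ :=
    h2.codRestrict_opens (coresComplement g) (fun b => (D.attachAux i b₀ hb₀ b).2)
  have h4 := h3.openEmbedding_comp D.hjA D.hjAo
  -- and `jB'ᵢ = jA ∘ attachAux` near `b₀`
  refine (h4.congr_of_eventuallyEq ?_).isImmersionAt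
  filter_upwards [hopen.mem_nhds hb₀] with b hb
  rw [D.jB'_of_ne_zero i hb, comp_apply, D.attachAux_of_ne i hb₀ hb]

/-- `jB'ᵢ` is an immersion at every point. [folklore] -/
theorem isImmersionAt_jB' (D : LocalityData g h P) (i : ι) (b₀ : ↥(beltPiece n k)) :
    Manifold.IsImmersionAt (𝓡∂ (n + 1)) (𝓡∂ (n + 1)) ∞ (D.jB' i) b₀ := by
  by_cases hb : lamSq k (((b₀ : 𝔻 (n + 1)) : 𝔼 (n + 1))) < D.ε
  · exact D.isImmersionAt_jB'_of_lt i hb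
  · exact D.isImmersionAt_jB'_of_ne i (D.lamSq_ne_zero_of_not_lt hb)

/-- **`jB'ᵢ` is an immersion** (equidimensional, so the pointwise complements glue).
[folklore] -/
theorem isImmersion_jB' (D : LocalityData g h P) (i : ι) :
    Manifold.IsImmersion (𝓡∂ (n + 1)) (𝓡∂ (n + 1)) ∞ (D.jB' i) :=
  Manifold.isImmersion_of_isImmersionAt_of_finrank_eq rfl (D.isImmersionAt_jB' i)

/-- `jB'ᵢ` is continuous. [folklore] -/
theorem continuous_jB' (D : LocalityData g h P) (i : ι) : Continuous (D.jB' i) :=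
  continuous_iff_continuousAt.2 fun b => (D.isImmersionAt_jB' i b).continuousAt

omit [IsManifold (𝓡∂ (n + 1)) ∞ M] [IsManifold (𝓡∂ (n + 1)) ∞ P] in
/-- **`jB'ᵢ` maps neighbourhoods to neighbourhoods** (it is locally one of two open maps).
[folklore] -/
theorem image_mem_nhds_jB' (D : LocalityData g h P) (i : ι) (b₀ : ↥(beltPiece n k))
    {s : Set ↥(beltPiece n k)} (hs : s ∈ 𝓝 b₀) : D.jB' i '' s ∈ 𝓝 (D.jB' i b₀) := by
  by_cases hb : lamSq k (((b₀ : 𝔻 (n + 1)) : 𝔼 (n + 1))) < D.ε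
  · -- near `b₀`, `jB'ᵢ = jBᵢ`, an open embedding
    have ho : IsOpenMap (D.jB i) :=
      (Topology.IsOpenEmbedding.mk (D.hjB i).1.isEmbedding (D.hjB i).2).isOpenMap
    set s' := s ∩ {b : ↥(beltPiece n k) | lamSq k (((b : 𝔻 (n + 1)) : 𝔼 (n + 1))) < D.ε}
    have hs' : s' ∈ 𝓝 b₀ :=
      inter_mem hs ((isOpen_lt (continuous_lamSq_beltPiece n k) continuous_const).mem_nhds hb)
    have h1 : D.jB i '' s' ∈ 𝓝 (D.jB' i b₀) := by rw [D.jB'_of_lt i hb]; exact ho.image_mem_nhds hs'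
    refine mem_of_superset h1 ?_
    rintro _ ⟨b, hb', rfl⟩
    exact ⟨b, hb'.1, D.jB'_of_lt i hb'.2⟩
  · have hb0 := D.lamSq_ne_zero_of_not_lt hb
    haveI : Nonempty ↥(handleTube n k) := ⟨handleInversionPt (b₀ : 𝔻 (n + 1)) hb0 b₀.2⟩
    set src := {b : ↥(beltPiece n k) | lamSq k (((b : 𝔻 (n + 1)) : 𝔼 (n + 1))) ≠ 0}
    have hsrc : src ∈ 𝓝 b₀ := (isOpen_ne.preimage (continuous_lamSq_beltPiece n k)).mem_nhds hb0
    -- `α (s ∩ src)` is a neighbourhood of `α b₀` in `T`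
    have h1 : handleInversionPH n k '' (s ∩ src) ∈ 𝓝 (handleInversionPH n k b₀) :=
      (handleInversionPH n k).image_mem_nhds hb0 (inter_mem hs hsrc)
    -- `h̄ᵢ` of it is a neighbourhood in `M`
    have h2 : (h i).toFun '' (handleInversionPH n k '' (s ∩ src)) ∈
        𝓝 ((h i).toFun (handleInversionPH n k b₀)) := (isOpenMap_toFun (h i)).image_mem_nhds h1
    -- in the open subspace `M ∖ ⋃ gᵢ(S)` it is a neighbourhood of `attach i b₀`
    have h3 : Subtype.val ⁻¹' ((h i).toFun '' (handleInversionPH n k '' (s ∩ src))) ∈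
        𝓝 (D.attach i b₀ hb0) := by
      refine continuous_subtype_val.continuousAt.preimage_mem_nhds ?_
      rw [coe_attach, ← handleInversionPH_apply n k hb0]; exact h2
    -- `jA` of that is a neighbourhood of `jB'ᵢ b₀`
    have h4 : D.jA '' (Subtype.val ⁻¹' ((h i).toFun '' (handleInversionPH n k '' (s ∩ src)))) ∈
        𝓝 (D.jB' i b₀) := by
      rw [D.jB'_of_ne_zero i hb0]
      exact (Topology.IsOpenEmbedding.mk D.hjA.isEmbedding D.hjAo).isOpenMap.image_mem_nhds h3
    refine mem_of_superset h4 ?_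
    rintro _ ⟨a, ha, rfl⟩
    obtain ⟨_, ⟨b, hb', rfl⟩, hya⟩ := ha
    refine ⟨b, hb'.1, ?_⟩
    have hb0' : lamSq k (((b : 𝔻 (n + 1)) : 𝔼 (n + 1))) ≠ 0 := hb'.2
    rw [D.jB'_of_ne_zero i hb0']
    congr 1
    apply Subtype.ext
    rw [coe_attach, ← handleInversionPH_apply n k hb0']
    exact hya

omit [IsManifold (𝓡∂ (n + 1)) ∞ M] [IsManifold (𝓡∂ (n + 1)) ∞ P] in
/-- `jB'ᵢ` is an open map. [folklore] -/
theorem isOpenMap_jB' (D : LocalityData g h P) (i : ι) : IsOpenMap (D.jB' i) :=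
  isOpenMap_iff_nhds_le.2 fun b => Filter.le_map fun _ hs => D.image_mem_nhds_jB' i b hs

/-- **`jB'ᵢ` is a smooth embedding with open range.** [folklore] -/
theorem isSmoothEmbedding_jB' (D : LocalityData g h P) (i : ι) :
    Manifold.IsSmoothEmbedding (𝓡∂ (n + 1)) (𝓡∂ (n + 1)) ∞ (D.jB' i) ∧ IsOpen (range (D.jB' i)) :=
  have ho : Topology.IsOpenEmbedding (D.jB' i) :=
    .of_continuous_injective_isOpenMap (D.continuous_jB' i) (D.injective_jB' i) (D.isOpenMap_jB' i)
  ⟨⟨D.isImmersion_jB' i, ho.isEmbedding⟩, ho.isOpen_range⟩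

/-- **The attachment along `h̄` assembled from the locality data.** [cite: Kosinski1993, VI §6] -/
theorem isMultiAttachment (D : LocalityData g h P) : IsMultiAttachment h (𝓡∂ (n + 1)) P := by
  refine ⟨D.disjoint, D.jA ∘ D.ccCongr, D.jB', ?_, ?_, D.isSmoothEmbedding_jB', D.cover',
    D.jA_eq_jB'_iff, D.disjointB'⟩
  · exact D.hjA.comp_openPartialHomeomorph D.ccCongr.toHomeomorph.toOpenPartialHomeomorph rfl
      (D.ccCongr.contMDiff.contMDiffOn.congr fun _ _ => rfl)
      (D.ccCongr.symm.contMDiff.contMDiffOn.congr fun _ _ => rfl)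
  · have hr : range (D.jA ∘ D.ccCongr) = range D.jA := D.ccCongr.surjective.range_comp _
    rw [hr]; exact D.hjAo

end Smooth

end LocalityData

/-- **Locality of handle attachments** (Kosinski 1993, VI §6 with VI §1, proof of (1.1):
the glued manifold only depends on the gluing map near the attaching sphere).  Let `g`, `h̄` be
finite families of attaching maps on `M` with `gᵢ = h̄ᵢ` on the neighbourhood
`{y ∈ T : |y_λ|² > 1 - ε}` of the attaching sphere `S`, for some `ε > 0`, the `h̄ᵢ` having
pairwise disjoint ranges.  Then every `P` which is `M` with handles attached along the `gᵢ` is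
`M` with handles attached along the `h̄ᵢ`. [cite: Kosinski1993, VI §6] -/
theorem IsMultiAttachment.of_eqOn_near_sphere [IsManifold (𝓡∂ (n + 1)) ∞ M]
    [IsManifold (𝓡∂ (n + 1)) ∞ P] (hP : IsMultiAttachment g (𝓡∂ (n + 1)) P) {ε : ℝ} (hε : 0 < ε)
    (heq : ∀ i (y : ↥(handleTube n k)), 1 - ε < lamSq k (((y : 𝔻 (n + 1)) : 𝔼 (n + 1))) →
      (g i).toFun y = (h i).toFun y)
    (hdisj : Pairwise fun i j => Disjoint (range (h i).toFun) (range (h j).toFun)) :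
    IsMultiAttachment h (𝓡∂ (n + 1)) P := by
  obtain ⟨hdisjG, jA, jB, hjA, hjAo, hjB, hcov, hglue, hdisjB⟩ := hP
  exact LocalityData.isMultiAttachment
    { ε := ε, ε_pos := hε, eqOn := heq, disjoint := hdisj, disjointG := hdisjG, jA := jA, jB := jB,
      hjA := hjA, hjAo := hjAo, hjB := hjB, cover := hcov, glue := hglue, disjointB := hdisjB }

/-- Locality, symmetric form: under agreement near `S` (and disjointness of both families) the
attachments along `g` and along `h̄` are the same. [cite: Kosinski1993, VI §6] -/
theorem isMultiAttachment_iff_of_eqOn_near_sphere [IsManifold (𝓡∂ (n + 1)) ∞ M]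
    [IsManifold (𝓡∂ (n + 1)) ∞ P] {ε : ℝ} (hε : 0 < ε)
    (heq : ∀ i (y : ↥(handleTube n k)), 1 - ε < lamSq k (((y : 𝔻 (n + 1)) : 𝔼 (n + 1))) →
      (g i).toFun y = (h i).toFun y)
    (hdisjG : Pairwise fun i j => Disjoint (range (g i).toFun) (range (g j).toFun))
    (hdisj : Pairwise fun i j => Disjoint (range (h i).toFun) (range (h j).toFun)) :
    IsMultiAttachment g (𝓡∂ (n + 1)) P ↔ IsMultiAttachment h (𝓡∂ (n + 1)) P :=
  ⟨fun hP => hP.of_eqOn_near_sphere hε heq hdisj,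
    fun hP => hP.of_eqOn_near_sphere hε (fun i y hy => (heq i y hy).symm) hdisjG⟩

omit [T2Space M] in
/-- **Agreement on an open neighbourhood of `S` gives agreement on some `{|y_λ|² > 1 - ε}`**
(compactness of the attaching sphere): the form in which locality is fed by the uniqueness of
tubular neighbourhoods. [folklore] -/
theorem exists_eqOn_near_sphere_of_eqOn_nhds {g h : HandleAttachingMap n k M}
    {U : Set ↥(handleTube n k)} (hU : IsOpen U)
    (hSU : ∀ y : ↥(handleTube n k), lamSq k (((y : 𝔻 (n + 1)) : 𝔼 (n + 1))) = 1 → y ∈ U)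
    (heq : ∀ y ∈ U, g.toFun y = h.toFun y) :
    ∃ ε > 0, ∀ y : ↥(handleTube n k), 1 - ε < lamSq k (((y : 𝔻 (n + 1)) : 𝔼 (n + 1))) →
      g.toFun y = h.toFun y := by
  -- work in the compact collar `K = {|y_λ|² ≥ 1/2} ⊆ T` of the sphere
  set f : ↥(handleTube n k) → ℝ := fun y => lamSq k (((y : 𝔻 (n + 1)) : 𝔼 (n + 1))) with hf
  have hfc : Continuous f := continuous_lamSq_handleTube n k
  set K : Set ↥(handleTube n k) := {y | (1 / 2 : ℝ) ≤ f y} with hK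
  have hemb : Topology.IsEmbedding (fun y : ↥(handleTube n k) => ((y : 𝔻 (n + 1)) : 𝔼 (n + 1))) :=
    Topology.IsEmbedding.subtypeVal.comp Topology.IsEmbedding.subtypeVal
  have hKc : IsCompact K := by
    rw [hemb.isCompact_iff]
    have himg : (fun y : ↥(handleTube n k) => ((y : 𝔻 (n + 1)) : 𝔼 (n + 1))) '' K =
        (𝔻 (n + 1)) ∩ {u | (1 / 2 : ℝ) ≤ lamSq k u} := by
      ext u
      constructor
      · rintro ⟨y, hy, rfl⟩
        exact ⟨(y : 𝔻 (n + 1)).2, hy⟩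
      · rintro ⟨hu, hu'⟩
        have hu0 : lamSq k u ≠ 0 := by intro h0; simp only [mem_setOf_eq, h0] at hu'; linarith
        exact ⟨⟨⟨u, hu⟩, hu0⟩, hu', rfl⟩
    rw [himg]
    exact (isCompact_closedBall _ _).inter_right (isClosed_le continuous_const (continuous_lamSq k))
  have hCc : IsCompact (K \ U) := hKc.diff hU
  by_cases hCe : K \ U = ∅
  · refine ⟨1 / 2, by norm_num, fun y hy => heq y ?_⟩
    by_contra hyU
    have : y ∈ K \ U := ⟨by show (1 / 2 : ℝ) ≤ f y; simp only [hf]; linarith, hyU⟩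
    rw [hCe] at this
    exact this
  · obtain ⟨y₀, hy₀, hmax⟩ :=
      hCc.exists_isMaxOn (Set.nonempty_iff_ne_empty.2 hCe) hfc.continuousOn
    have hle : f y₀ ≤ 1 := lamSq_le_one (mem_closedBall_zero_iff.1 ((y₀ : 𝔻 (n + 1)).2))
    have hlt : f y₀ < 1 := lt_of_le_of_ne hle fun h1 => hy₀.2 (hSU y₀ h1)
    refine ⟨min (1 / 2) (1 - f y₀), lt_min (by norm_num) (by linarith), fun y hy => heq y ?_⟩
    by_contra hyU
    have hyK : y ∈ K := by
      show (1 / 2 : ℝ) ≤ f y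
      have := min_le_left (1 / 2 : ℝ) (1 - f y₀)
      simp only [hf] at hy ⊢; linarith
    have h1 : f y ≤ f y₀ := hmax ⟨hyK, hyU⟩
    have h2 := min_le_right (1 / 2 : ℝ) (1 - f y₀)
    simp only [hf] at hy h1 h2
    linarith

end HandleAttachingMap

end Literature.Topology.FourManifolds

end
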